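import Mathlib
import Literature.RingTheory.CohomologyAnnihilator.TowerRestrict
import HarnessLib

/-!
# A module is a retract of the restriction of its base change when `A` splits off `B`

Topic: `Literature/RingTheory/CohomologyAnnihilator`.  In the descent step of the proof of
[IyengarTakahashi2014, Theorem 5.4] (adapting Keller–Van den Bergh, Prop. 5.1.2) a finitely
generated `A`-module is recovered as a DIRECT SUMMAND of the restriction of scalars of its base
change: "`M` is a direct summand of `(M ⊗ₖ K)|_A = M^{(I)}`" (a `k`-basis of `K` containing `1`).
The general mechanism:

* `exists_retract_restrictScalars_baseChange` — if the structure map `A → B` admits an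
  `A`-linear retraction `ρ : B → A` with `ρ 1 = 1` (i.e. `A` is an `A`-module direct summand of
  `B` through the unit; e.g. `B = A ⊗ₖ K` for a field extension `K/k`), then every `A`-module
  `N` is a retract of `(B ⊗_A N)|_A`: `N → (B ⊗_A N)|_A → N`, `n ↦ 1 ⊗ n`, `b ⊗ n ↦ ρ(b) n`,
  composes to the identity.
* `InTower.of_baseChange` — hence, if `B ⊗_A N ∈ |G|ₙ` over `B`, then `N ∈ |G|_A|ₙ` over `A`
  (`InTower.restrictScalars`, `InTower.of_retract` of `TowerRestrict.lean` / `TowerBasic.lean`).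
* `InTower.of_baseChange_tensorProduct` — the case `B = A ⊗ₖ K` for a field extension `K/k`
  (the hypothesis holds: tensor a `k`-linear retraction of `k → K` with `A`,
  `exists_retraction_tensorProduct`).

Pieces D3/D4-lite of the chain's split of the descent input `h_desc` of
`singEqVCa_essFiniteType_of_inputs` (`SingEqVCaOfDescent.lean`), composable with
`IsSyzygy.baseChange` (`SyzygyBaseChange.lean`).

## References

* S. B. Iyengar, R. Takahashi, *Annihilation of cohomology and strong generation of module
  categories*, IMRN 2016; arXiv:1404.1476 — proof of Theorem 5.4. [`IyengarTakahashi2014`]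
* B. Keller, M. Van den Bergh, *Deformed Calabi–Yau completions*, Prop. 5.1.2 (the argument
  adapted there).
-/

noncomputable section

open CategoryTheory
open scoped TensorProduct

universe u

namespace Literature.RingTheory.CohomologyAnnihilator

variable (A B : Type u) [CommRing A] [CommRing B] [Algebra A B]

/-- **`N` is a retract of `(B ⊗_A N)|_A` when `A` splits off `B` through the unit.** Given an
`A`-linear `ρ : B → A` with `ρ 1 = 1`, the maps `n ↦ 1 ⊗ n` and `b ⊗ n ↦ ρ(b) • n` exhibit
every `A`-module `N` as a direct summand of the restriction of scalars of `B ⊗_A N` (the step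
"`M` is a direct summand of `(M_K)|_A`" of the descent in the proof of Theorem 5.4).
[cite: IyengarTakahashi2014, Thm. 5.4 (proof)] -/
theorem exists_retract_restrictScalars_baseChange (ρ : B →ₗ[A] A) (hρ : ρ 1 = 1)
    (N : ModuleCat.{u} A) :
    ∃ (i : N ⟶ (restrictScalarsFunctor A B).obj (ModuleCat.of B (B ⊗[A] N)))
      (p : (restrictScalarsFunctor A B).obj (ModuleCat.of B (B ⊗[A] N)) ⟶ N), i ≫ p = 𝟙 N := by
  -- the `A`-linear map `b ⊗ n ↦ ρ(b) • n` on `B ⊗_A N` (natural `A`-structure)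
  let p₀ : B ⊗[A] N →ₗ[A] N := TensorProduct.lift ((LinearMap.lsmul A N).comp ρ)
  have hp₀ : ∀ (b : B) (n : N), p₀ (b ⊗ₜ[A] n) = ρ b • n := fun b n => by
    simp [p₀]
  have hp₀smul : ∀ (a : A) (x : B ⊗[A] N), p₀ (algebraMap A B a • x) = a • p₀ x := fun a x => by
    rw [algebraMap_smul, map_smul]
  have hismul : ∀ (a : A) (n : N),
      (1 : B) ⊗ₜ[A] (a • n) = algebraMap A B a • ((1 : B) ⊗ₜ[A] n) := fun a n => by
    rw [algebraMap_smul, TensorProduct.smul_tmul', TensorProduct.smul_tmul]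
  -- now switch to the restricted `A`-structure (`a • x := algebraMap a • x`)
  letI : Module A (B ⊗[A] N) :=
    ((restrictScalarsFunctor A B).obj (ModuleCat.of B (B ⊗[A] N))).isModule
  let i₀ : N →ₗ[A] (restrictScalarsFunctor A B).obj (ModuleCat.of B (B ⊗[A] N)) :=
    { toFun := fun n => (1 : B) ⊗ₜ[A] n
      map_add' := fun x y => TensorProduct.tmul_add _ _ _
      map_smul' := fun a n => hismul a n }
  let p₁ : (restrictScalarsFunctor A B).obj (ModuleCat.of B (B ⊗[A] N)) →ₗ[A] N :=
    { toFun := fun x => p₀ x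
      map_add' := fun x y => map_add p₀ x y
      map_smul' := fun a x => hp₀smul a x }
  refine ⟨ModuleCat.ofHom i₀, ModuleCat.ofHom p₁, ?_⟩
  refine ModuleCat.hom_ext (LinearMap.ext fun n => ?_)
  change p₀ ((1 : B) ⊗ₜ[A] n) = n
  rw [hp₀, hρ, one_smul]

/-- **Descent of tower membership along a unit-split base change**: with `ρ` as above, if
`B ⊗_A N ∈ |G|ₙ` over `B` then `N ∈ |G|_A|ₙ` over `A` (restrict scalars, then pass to the retract
`N`). [cite: IyengarTakahashi2014, Thm. 5.4 (proof)] -/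
theorem InTower.of_baseChange (ρ : B →ₗ[A] A) (hρ : ρ 1 = 1) {G : ModuleCat.{u} B} {n : ℕ}
    {N : ModuleCat.{u} A} (h : InTower G n (ModuleCat.of B (B ⊗[A] N))) :
    InTower ((restrictScalarsFunctor A B).obj G) n N := by
  obtain ⟨i, p, hip⟩ := exists_retract_restrictScalars_baseChange A B ρ hρ N
  exact (InTower.restrictScalars (R := A) h).of_retract i p hip

/-- **The unit of a field extension splits after base change**: for a field extension `K/k` and
a `k`-algebra `A`, the structure map `A → A ⊗ₖ K` has an `A`-linear retraction `ρ` with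
`ρ 1 = 1` (tensor a `k`-linear retraction of `k → K` with `A`). [folklore] -/
private theorem exists_retraction_tensorProduct (k : Type u) [Field k] (K : Type u) [Field K]
    [Algebra k K] (A : Type u) [CommRing A] [Algebra k A] :
    ∃ ρ : A ⊗[k] K →ₗ[A] A, ρ 1 = 1 := by
  -- a `k`-linear retraction of `k → K`
  obtain ⟨r, hr⟩ := LinearMap.exists_leftInverse_of_injective (Algebra.linearMap k K)
    (by rw [LinearMap.ker_eq_bot]; exact (algebraMap k K).injective)
  have hr1 : r 1 = 1 := by
    have := LinearMap.congr_fun hr (1 : k)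
    simpa using this
  refine ⟨(TensorProduct.AlgebraTensorModule.rid k A A).toLinearMap ∘ₗ
    TensorProduct.AlgebraTensorModule.map LinearMap.id r, ?_⟩
  rw [Algebra.TensorProduct.one_def]
  simp [hr1]

/-- **Descent of tower membership from `A ⊗ₖ K` to `A`** (field extension `K/k`): if
`(A ⊗ₖ K) ⊗_A N ∈ |G|ₙ` over `A ⊗ₖ K` then `N ∈ |G|_A|ₙ` over `A`.
[cite: IyengarTakahashi2014, Thm. 5.4 (proof)] -/
theorem InTower.of_baseChange_tensorProduct (k : Type u) [Field k] (K : Type u) [Field K]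
    [Algebra k K] (A : Type u) [CommRing A] [Algebra k A] {G : ModuleCat.{u} (A ⊗[k] K)} {n : ℕ}
    {N : ModuleCat.{u} A} (h : InTower G n (ModuleCat.of (A ⊗[k] K) ((A ⊗[k] K) ⊗[A] N))) :
    InTower ((restrictScalarsFunctor A (A ⊗[k] K)).obj G) n N := by
  obtain ⟨ρ, hρ⟩ := exists_retraction_tensorProduct k K A
  exact InTower.of_baseChange A (A ⊗[k] K) ρ hρ h

end Literature.RingTheory.CohomologyAnnihilator

end
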